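import Literature.NumberTheory.Sieve.FordMaynardSliceConvolution
import Literature.Analysis.Convolution.ModifiedLiouville
import HarnessLib

/-!
# Ford–Maynard §9.2: the function `f ∈ 𝔉*_η(γ)` with `f(1) < −1 ≤ f|_{dim ≥ 2}` — construction

Everything PROVED. For `1/2 < γ < 1` we follow K. Ford, J. Maynard, arXiv:2407.14368, §9.2,
with the modified Liouville functions realised in the 1-D convolution model of
`Literature/Analysis/Convolution/ModifiedLiouville.lean`:

* parameters `c₁ = 1 − γ`, `c₂ = c₁/2`, `ε = c₂³/18`, `g₀ = 2^{⌈1/ε⌉}`, `η = min(ε/2, c₁³/(18 g₀))`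
  (`cOne`, `cTwo`, `epsP`, `gZero`, `etaP`) and their inequalities (`kappa_two_le : κ₂/ε ≤ 1/4`,
  `kappa_one_le : κ₁/η ≤ 1/(4 g₀)`);
* `M₁ = M^{(c₁,η)}`, `M₂ = M^{(c₂,ε)}` (`MOne`, `MTwo`): `= −1` on `[thr, c)`, `0` below the
  threshold, `−1 ≤ M₁ ≤ −1 + 1/(4g₀)` on `[η,1]`, `−1 ≤ M₂ ≤ −3/4` on `[ε,1]`;
* **`fmF γ`**: `f(ξ) = ∏ M₁(ξ_i) + (1 − 2^{k−3}) ∏ M₂(ξ_i)/g₀` on `ξ ∈ ℝ^k` with `∑ ξ_i = 1`, else `0`;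
  `fmF_symmetric`, `fmF_support`, `fmF_bounded`;
* values: `fmF_one_lt : f(1) < −1`, `fmF_ge_neg_one : f ≥ −1` in dimension `≥ 2` (parity cases);
* **`fmF_typeI : TypeIIdentity γ (fmF γ)`** — (TypeI-f): on the slice the integrand is
  `A₁ ∏ ℓ₁(u_j) + B_d ∏ ℓ₂(u_j)`, its slice integral is `A₁ ℓ₁^{⋆d}(w) + B_d ℓ₂^{⋆d}(w)`
  (`sliceIntegral_prod_eq_cpow`), and the three sums over `d` vanish by `sum_cpow_ellFn_eq_zero`
  with `m = 1` (`ℓ₁`, `c₁ ≤ w`), `m = 1, 2` (`ℓ₂`, `2c₂ = c₁ ≤ w`) — FM Lemma 9.5 "two applications".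

The piecewise-Lipschitz structure (Definition 6.2 (b)) and the assembly `MemTypeIStar` are in
`FordMaynardTypeIStarPieces.lean`.
-/

noncomputable section

namespace Literature.NumberTheory.Sieve.FordMaynard

open MeasureTheory Set Finset Literature.Analysis.Convolution Literature.Combinatorics.Enumerative

/-! ### Parameters of the construction (Ford–Maynard §9.2) -/

section Params

/-- `c₁ = 1 − γ` (Type-I parameter of `M₁ = M^{(1−γ, η)}`). [cite: FordMaynard2024PrimeSieves, §9.2] -/
def cOne (γ : ℝ) : ℝ := 1 - γ
/-- `c₂ = (1 − γ)/2` (parameter of `M₂ = M^{(c, ε)}`). [cite: FordMaynard2024PrimeSieves, §9.2] -/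
def cTwo (γ : ℝ) : ℝ := (1 - γ) / 2
/-- `ε = c₂³/18`, small enough that `M₂ ≤ −3/4` on `[ε, 1]`. [cite: FordMaynard2024PrimeSieves, §9.2] -/
def epsP (γ : ℝ) : ℝ := cTwo γ ^ 3 / 18
/-- `g₀ = 2^{⌈1/ε⌉}` bounds `|g|`. [cite: FordMaynard2024PrimeSieves, §9.2] -/
def gZero (γ : ℝ) : ℝ := 2 ^ ⌈1 / epsP γ⌉₊
/-- `η = min(ε/2, c₁³/(18 g₀))`, small enough that `M₁ ≤ −1 + 1/(4 g₀)` on `[η, 1]`.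
[cite: FordMaynard2024PrimeSieves, §9.2] -/
def etaP (γ : ℝ) : ℝ := min (epsP γ / 2) (cOne γ ^ 3 / (18 * gZero γ))

variable {γ : ℝ}

/-- `0 < c₁`. [cite: FordMaynard2024PrimeSieves, §9.2] -/
theorem cOne_pos (hγ1 : γ < 1) : 0 < cOne γ := by unfold cOne; linarith
/-- `c₁ < 1/2`. [cite: FordMaynard2024PrimeSieves, §9.2] -/
theorem cOne_lt (hγ : 1 / 2 < γ) : cOne γ < 1 / 2 := by unfold cOne; linarith
/-- `0 < c₂`. [cite: FordMaynard2024PrimeSieves, §9.2] -/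
theorem cTwo_pos (hγ1 : γ < 1) : 0 < cTwo γ := by unfold cTwo; linarith
/-- `c₂ < 1/4`. [cite: FordMaynard2024PrimeSieves, §9.2] -/
theorem cTwo_lt (hγ : 1 / 2 < γ) : cTwo γ < 1 / 4 := by unfold cTwo; linarith
/-- `2 c₂ = c₁`. [cite: FordMaynard2024PrimeSieves, §9.2] -/
theorem two_mul_cTwo (γ : ℝ) : 2 * cTwo γ = cOne γ := by unfold cTwo cOne; ring
/-- `0 < ε`. [cite: FordMaynard2024PrimeSieves, §9.2] -/
theorem epsP_pos (hγ1 : γ < 1) : 0 < epsP γ := by unfold epsP; have := cTwo_pos hγ1; positivity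
/-- `ε ≤ c₂/3`. [cite: FordMaynard2024PrimeSieves, §9.2] -/
theorem epsP_le (hγ : 1 / 2 < γ) (hγ1 : γ < 1) : epsP γ ≤ cTwo γ / 3 := by
  unfold epsP
  have h0 := cTwo_pos hγ1
  have h1 := cTwo_lt hγ
  have : cTwo γ ^ 2 ≤ 1 := by nlinarith
  nlinarith
/-- `3ε ≤ c₂`. [cite: FordMaynard2024PrimeSieves, §9.2] -/
theorem three_mul_epsP_le (hγ : 1 / 2 < γ) (hγ1 : γ < 1) : 3 * epsP γ ≤ cTwo γ := by
  linarith [epsP_le hγ hγ1]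
/-- `1 ≤ g₀`. [cite: FordMaynard2024PrimeSieves, §9.2] -/
theorem one_le_gZero (γ : ℝ) : 1 ≤ gZero γ := by unfold gZero; exact one_le_pow₀ (by norm_num)
/-- `0 < g₀`. [cite: FordMaynard2024PrimeSieves, §9.2] -/
theorem gZero_pos (γ : ℝ) : 0 < gZero γ := lt_of_lt_of_le one_pos (one_le_gZero γ)
/-- `0 < η`. [cite: FordMaynard2024PrimeSieves, §9.2] -/
theorem etaP_pos (hγ1 : γ < 1) : 0 < etaP γ := by
  unfold etaP
  have := epsP_pos hγ1; have := cOne_pos hγ1; have := gZero_pos γ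
  exact lt_min (by positivity) (by positivity)
/-- `η < ε`. [cite: FordMaynard2024PrimeSieves, §9.2] -/
theorem etaP_lt_epsP (hγ1 : γ < 1) : etaP γ < epsP γ := by
  have := epsP_pos hγ1
  exact (min_le_left _ _).trans_lt (by linarith)
/-- `η ≤ c₁³/(18 g₀)`. [cite: FordMaynard2024PrimeSieves, §9.2] -/
theorem etaP_le (γ : ℝ) : etaP γ ≤ cOne γ ^ 3 / (18 * gZero γ) := min_le_right _ _
/-- `3η ≤ c₁`. [cite: FordMaynard2024PrimeSieves, §9.2] -/
theorem three_mul_etaP_le (hγ : 1 / 2 < γ) (hγ1 : γ < 1) : 3 * etaP γ ≤ cOne γ := by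
  have h := etaP_le γ
  have h0 := cOne_pos hγ1
  have h1 := cOne_lt hγ
  have hg := one_le_gZero γ
  have : cOne γ ^ 3 / (18 * gZero γ) ≤ cOne γ ^ 3 / 18 :=
    div_le_div_of_nonneg_left (by positivity) (by norm_num) (by linarith)
  have : cOne γ ^ 2 ≤ 1 := by nlinarith
  nlinarith
/-- `η ≤ 1`. [cite: FordMaynard2024PrimeSieves, §9.2] -/
theorem etaP_le_one (hγ : 1 / 2 < γ) (hγ1 : γ < 1) : etaP γ ≤ 1 := by
  linarith [three_mul_etaP_le hγ hγ1, cOne_lt hγ, etaP_pos hγ1]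
/-- `ε ≤ 1`. [cite: FordMaynard2024PrimeSieves, §9.2] -/
theorem epsP_le_one (hγ : 1 / 2 < γ) (hγ1 : γ < 1) : epsP γ ≤ 1 := by
  linarith [three_mul_epsP_le hγ hγ1, cTwo_lt hγ, epsP_pos hγ1]
/-- `c₁ ≤ 1`. [cite: FordMaynard2024PrimeSieves, §9.2] -/
theorem cOne_le_one (hγ : 1 / 2 < γ) : cOne γ ≤ 1 := by linarith [cOne_lt hγ]
/-- `c₂ ≤ 1`. [cite: FordMaynard2024PrimeSieves, §9.2] -/
theorem cTwo_le_one (hγ : 1 / 2 < γ) : cTwo γ ≤ 1 := by linarith [cTwo_lt hγ]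
/-- `c₂ < c₁`. [cite: FordMaynard2024PrimeSieves, §9.2] -/
theorem cTwo_lt_cOne (hγ1 : γ < 1) : cTwo γ < cOne γ := by unfold cTwo cOne; linarith

/-- `(1/ε) κ(ε, c₂) ≤ 1/4`. [cite: FordMaynard2024PrimeSieves, §9.2 (choice of ε)] -/
theorem kappa_two_le (hγ : 1 / 2 < γ) (hγ1 : γ < 1) : dkKappa (epsP γ) (cTwo γ) / epsP γ ≤ 1 / 4 := by
  have he := epsP_pos hγ1
  have hc := cTwo_pos hγ1
  have hle := epsP_le hγ hγ1
  unfold dkKappa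
  have h1 : 2 * cTwo γ / 3 ≤ cTwo γ - epsP γ := by linarith
  have h2 : cTwo γ / 3 ≤ cTwo γ - 2 * epsP γ := by linarith
  have hden : cTwo γ * (2 * cTwo γ / 3) * (cTwo γ / 3) ≤ cTwo γ * (cTwo γ - epsP γ) * (cTwo γ - 2 * epsP γ) := by
    apply mul_le_mul (mul_le_mul_of_nonneg_left h1 hc.le) h2 (by linarith)
      (mul_nonneg hc.le (by linarith))
  have hden0 : 0 < cTwo γ * (2 * cTwo γ / 3) * (cTwo γ / 3) := by positivity
  calc epsP γ ^ 2 / (cTwo γ * (cTwo γ - epsP γ) * (cTwo γ - 2 * epsP γ)) / epsP γ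
      = epsP γ / (cTwo γ * (cTwo γ - epsP γ) * (cTwo γ - 2 * epsP γ)) := by
        field_simp
    _ ≤ epsP γ / (cTwo γ * (2 * cTwo γ / 3) * (cTwo γ / 3)) :=
        div_le_div_of_nonneg_left he.le hden0 hden
    _ = (cTwo γ ^ 3 / 18) / (cTwo γ * (2 * cTwo γ / 3) * (cTwo γ / 3)) := by rw [epsP]
    _ = 1 / 4 := by field_simp; ring

/-- `(1/η) κ(η, c₁) ≤ 1/(4 g₀)`. [cite: FordMaynard2024PrimeSieves, §9.2 (choice of η)] -/
theorem kappa_one_le (hγ : 1 / 2 < γ) (hγ1 : γ < 1) :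
    dkKappa (etaP γ) (cOne γ) / etaP γ ≤ 1 / (4 * gZero γ) := by
  have he := etaP_pos hγ1
  have hc := cOne_pos hγ1
  have hg := gZero_pos γ
  have h3 := three_mul_etaP_le hγ hγ1
  have hle : etaP γ ≤ cOne γ / 3 := by linarith
  unfold dkKappa
  have h1 : 2 * cOne γ / 3 ≤ cOne γ - etaP γ := by linarith
  have h2 : cOne γ / 3 ≤ cOne γ - 2 * etaP γ := by linarith
  have hden : cOne γ * (2 * cOne γ / 3) * (cOne γ / 3) ≤ cOne γ * (cOne γ - etaP γ) * (cOne γ - 2 * etaP γ) := by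
    apply mul_le_mul (mul_le_mul_of_nonneg_left h1 hc.le) h2 (by linarith)
      (mul_nonneg hc.le (by linarith))
  have hden0 : 0 < cOne γ * (2 * cOne γ / 3) * (cOne γ / 3) := by positivity
  calc etaP γ ^ 2 / (cOne γ * (cOne γ - etaP γ) * (cOne γ - 2 * etaP γ)) / etaP γ
      = etaP γ / (cOne γ * (cOne γ - etaP γ) * (cOne γ - 2 * etaP γ)) := by
        field_simp
    _ ≤ etaP γ / (cOne γ * (2 * cOne γ / 3) * (cOne γ / 3)) :=
        div_le_div_of_nonneg_left he.le hden0 hden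
    _ ≤ (cOne γ ^ 3 / (18 * gZero γ)) / (cOne γ * (2 * cOne γ / 3) * (cOne γ / 3)) :=
        div_le_div_of_nonneg_right (etaP_le γ) hden0.le
    _ = 1 / (4 * gZero γ) := by field_simp; ring

end Params

/-! ### The two modified Liouville functions and the function `f` -/

section Construction

variable {γ : ℝ}

/-- `M₁ = M^{(1−γ, η)}`. [cite: FordMaynard2024PrimeSieves, §9.2] -/
def MOne (γ : ℝ) : ℝ → ℝ := modLiouville (etaP γ) (cOne γ)
/-- `M₂ = M^{((1−γ)/2, ε)}`. [cite: FordMaynard2024PrimeSieves, §9.2] -/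
def MTwo (γ : ℝ) : ℝ → ℝ := modLiouville (epsP γ) (cTwo γ)

/-- `M₁ = 0` below `η`. [cite: FordMaynard2024PrimeSieves, §9.2] -/
theorem MOne_of_lt (hγ1 : γ < 1) {a : ℝ} (ha : a < etaP γ) : MOne γ a = 0 :=
  modLiouville_of_lt (etaP_pos hγ1) ha

/-- `M₂ = 0` below `ε`. [cite: FordMaynard2024PrimeSieves, §9.2] -/
theorem MTwo_of_lt (hγ1 : γ < 1) {a : ℝ} (ha : a < epsP γ) : MTwo γ a = 0 :=
  modLiouville_of_lt (epsP_pos hγ1) ha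

/-- `M₁ = −1` on `[η, c₁)`. [cite: FordMaynard2024PrimeSieves, §9.2] -/
theorem MOne_eq_neg_one (hγ : 1 / 2 < γ) (hγ1 : γ < 1) {a : ℝ} (h1 : etaP γ ≤ a) (h2 : a < cOne γ) :
    MOne γ a = -1 :=
  modLiouville_eq_neg_one (etaP_pos hγ1) (by linarith [cOne_le_one hγ]) h1 h2

/-- `M₂ = −1` on `[ε, c₂)`. [cite: FordMaynard2024PrimeSieves, §9.2] -/
theorem MTwo_eq_neg_one (hγ : 1 / 2 < γ) (hγ1 : γ < 1) {a : ℝ} (h1 : epsP γ ≤ a) (h2 : a < cTwo γ) :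
    MTwo γ a = -1 :=
  modLiouville_eq_neg_one (epsP_pos hγ1) (by linarith [cTwo_le_one hγ]) h1 h2

/-- `−1 ≤ M₁ ≤ −1 + 1/(4 g₀)` on `[η, 1]`. [cite: FordMaynard2024PrimeSieves, §9.2 (deleps)] -/
theorem MOne_bounds (hγ : 1 / 2 < γ) (hγ1 : γ < 1) {a : ℝ} (h1 : etaP γ ≤ a) (h2 : a ≤ 1) :
    -1 ≤ MOne γ a ∧ MOne γ a ≤ -1 + 1 / (4 * gZero γ) := by
  obtain ⟨hl, hu⟩ := modLiouville_bounds (etaP_pos hγ1) (etaP_le_one hγ hγ1)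
    (three_mul_etaP_le hγ hγ1) (cOne_le_one hγ) h1 h2
  refine ⟨hl, hu.trans ?_⟩
  have hk := kappa_one_le hγ hγ1
  have he := etaP_pos hγ1
  have hκ0 := dkKappa_nonneg he (three_mul_etaP_le hγ hγ1)
  have ha0 : 0 ≤ a := le_trans he.le h1
  have : a ^ 2 / etaP γ * dkKappa (etaP γ) (cOne γ) ≤ dkKappa (etaP γ) (cOne γ) / etaP γ := by
    rw [div_mul_eq_mul_div]
    refine div_le_div_of_nonneg_right ?_ he.le
    have ha2 : a ^ 2 ≤ 1 := by nlinarith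
    nlinarith [mul_le_mul_of_nonneg_right ha2 hκ0]
  linarith

/-- `−1 ≤ M₂ ≤ −3/4` on `[ε, 1]`. [cite: FordMaynard2024PrimeSieves, §9.2 (Mac-ineq)] -/
theorem MTwo_bounds (hγ : 1 / 2 < γ) (hγ1 : γ < 1) {a : ℝ} (h1 : epsP γ ≤ a) (h2 : a ≤ 1) :
    -1 ≤ MTwo γ a ∧ MTwo γ a ≤ -3 / 4 := by
  obtain ⟨hl, hu⟩ := modLiouville_bounds (epsP_pos hγ1) (epsP_le_one hγ hγ1)
    (three_mul_epsP_le hγ hγ1) (cTwo_le_one hγ) h1 h2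
  refine ⟨hl, hu.trans ?_⟩
  have hk := kappa_two_le hγ hγ1
  have he := epsP_pos hγ1
  have hκ0 := dkKappa_nonneg he (three_mul_epsP_le hγ hγ1)
  have ha0 : 0 ≤ a := le_trans he.le h1
  have : a ^ 2 / epsP γ * dkKappa (epsP γ) (cTwo γ) ≤ dkKappa (epsP γ) (cTwo γ) / epsP γ := by
    rw [div_mul_eq_mul_div]
    refine div_le_div_of_nonneg_right ?_ he.le
    have ha2 : a ^ 2 ≤ 1 := by nlinarith
    nlinarith [mul_le_mul_of_nonneg_right ha2 hκ0]
  linarith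

/-- `|M₁| ≤ 1` on `[η, 1]` and `M₁ ≤ 0` there. [cite: FordMaynard2024PrimeSieves, §9.2] -/
theorem MOne_abs_le (hγ : 1 / 2 < γ) (hγ1 : γ < 1) {a : ℝ} (h1 : etaP γ ≤ a) (h2 : a ≤ 1) :
    |MOne γ a| ≤ 1 ∧ MOne γ a ≤ 0 := by
  obtain ⟨hl, hu⟩ := MOne_bounds hγ hγ1 h1 h2
  have hg := one_le_gZero γ
  have : 1 / (4 * gZero γ) ≤ 1 / 4 := div_le_div_of_nonneg_left zero_le_one (by norm_num) (by linarith)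
  exact ⟨abs_le.2 ⟨hl, by linarith⟩, by linarith⟩

/-- `|M₂| ≤ 1` and `M₂ ≤ 0` everywhere on `(−∞, 1]`. [cite: FordMaynard2024PrimeSieves, §9.2] -/
theorem MTwo_abs_le (hγ : 1 / 2 < γ) (hγ1 : γ < 1) {a : ℝ} (h2 : a ≤ 1) :
    |MTwo γ a| ≤ 1 ∧ MTwo γ a ≤ 0 := by
  rcases lt_or_ge a (epsP γ) with h | h
  · rw [MTwo_of_lt hγ1 h]; simp
  · obtain ⟨hl, hu⟩ := MTwo_bounds hγ hγ1 h h2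
    exact ⟨abs_le.2 ⟨hl, by linarith⟩, by linarith⟩

/-- `|M₁| ≤ 1` and `M₁ ≤ 0` on `(−∞, 1]`. [cite: FordMaynard2024PrimeSieves, §9.2] -/
theorem MOne_abs_le' (hγ : 1 / 2 < γ) (hγ1 : γ < 1) {a : ℝ} (h2 : a ≤ 1) :
    |MOne γ a| ≤ 1 ∧ MOne γ a ≤ 0 := by
  rcases lt_or_ge a (etaP γ) with h | h
  · rw [MOne_of_lt hγ1 h]; simp
  · exact MOne_abs_le hγ hγ1 h h2

/-- **The function `f`** of Ford–Maynard §9.2: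
`f(ξ) = λ̃₁(ξ) + g(ξ)/g₀`, `λ̃₁(ξ) = ∏ M₁(ξ_i)`, `g(ξ) = (1 − 2^{k−3}) ∏ M₂(ξ_i)`, on vectors
`ξ ∈ ℝ^k` summing to `1`, and `0` otherwise. [cite: FordMaynard2024PrimeSieves, §9.2] -/
def fmF (γ : ℝ) : VecFn := fun k v =>
  if ∑ i, v i = 1 then (∏ i, MOne γ (v i)) + (1 - (2:ℝ) ^ k / 8) * (∏ i, MTwo γ (v i)) / gZero γ
  else 0

/-- Symmetry of `f`. [cite: FordMaynard2024PrimeSieves, §9.2] -/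
theorem fmF_symmetric (γ : ℝ) : (fmF γ).IsSymmetric := by
  intro k σ v
  unfold fmF
  have h1 : ∑ i, (v ∘ σ) i = ∑ i, v i := Equiv.sum_comp σ v
  have h2 : ∏ i, MOne γ ((v ∘ σ) i) = ∏ i, MOne γ (v i) := Equiv.prod_comp σ (fun i => MOne γ (v i))
  have h3 : ∏ i, MTwo γ ((v ∘ σ) i) = ∏ i, MTwo γ (v i) := Equiv.prod_comp σ (fun i => MTwo γ (v i))
  simp only [Function.comp] at h1 h2 h3 ⊢
  rw [h1, h2, h3]

/-- On the support of `f` the components are `≥ η` and sum to `1`. [cite: FordMaynard2024PrimeSieves, §9.2] -/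
theorem fmF_support (hγ1 : γ < 1) (k : ℕ) (v : Fin k → ℝ) (hv : fmF γ k v ≠ 0) :
    (∀ i, etaP γ ≤ v i) ∧ ∑ i, v i = 1 := by
  unfold fmF at hv
  split_ifs at hv with hs
  · refine ⟨fun i => ?_, hs⟩
    by_contra hi
    have hi' : v i < etaP γ := not_le.1 hi
    apply hv
    rw [Finset.prod_eq_zero (Finset.mem_univ i) (MOne_of_lt hγ1 hi'),
      Finset.prod_eq_zero (Finset.mem_univ i) (MTwo_of_lt hγ1 (hi'.trans (etaP_lt_epsP hγ1)))]
    simp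
  · exact absurd rfl hv

/-- A vector with components `≥ η > 0` summing to `1` has each component `≤ 1` and dimension
`≤ 1/η`. [folklore] -/
theorem le_one_of_support {η : ℝ} (hη : 0 < η) {k : ℕ} {v : Fin k → ℝ} (h1 : ∀ i, η ≤ v i)
    (h2 : ∑ i, v i = 1) : (∀ i, v i ≤ 1) ∧ (k : ℝ) * η ≤ 1 := by
  refine ⟨fun i => ?_, ?_⟩
  · have := Finset.single_le_sum (f := v) (fun j _ => (hη.le.trans (h1 j))) (Finset.mem_univ i)
    linarith
  · calc (k : ℝ) * η = ∑ _i : Fin k, η := by simp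
      _ ≤ ∑ i, v i := Finset.sum_le_sum fun i _ => h1 i
      _ = 1 := h2

/-- `|∏ φ(v_i)| ≤ 1` if `|φ(v_i)| ≤ 1` for all `i`. [folklore] -/
theorem abs_prod_le_one {k : ℕ} {φ : ℝ → ℝ} {v : Fin k → ℝ} (h : ∀ i, |φ (v i)| ≤ 1) :
    |∏ i, φ (v i)| ≤ 1 := by
  rw [Finset.abs_prod]
  exact Finset.prod_le_one (fun i _ => abs_nonneg _) fun i _ => h i

/-- `f` is bounded. [cite: FordMaynard2024PrimeSieves, §9.2] -/
theorem fmF_bounded (hγ : 1 / 2 < γ) (hγ1 : γ < 1) :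
    ∃ F : ℝ, ∀ (k : ℕ) (v : Fin k → ℝ), |fmF γ k v| ≤ F := by
  refine ⟨1 + (1 + 2 ^ ⌊1 / etaP γ⌋₊ / 8) / gZero γ, fun k v => ?_⟩
  have hg := gZero_pos γ
  by_cases hz : fmF γ k v = 0
  · rw [hz, abs_zero]; positivity
  obtain ⟨h1, h2⟩ := fmF_support hγ1 k v hz
  obtain ⟨hle1, hk⟩ := le_one_of_support (etaP_pos hγ1) h1 h2
  have hkf : k ≤ ⌊1 / etaP γ⌋₊ := Nat.le_floor (by rw [le_div_iff₀ (etaP_pos hγ1)]; exact hk)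
  unfold fmF
  rw [if_pos h2]
  have hA : |∏ i, MOne γ (v i)| ≤ 1 := abs_prod_le_one fun i => (MOne_abs_le' hγ hγ1 (hle1 i)).1
  have hB : |∏ i, MTwo γ (v i)| ≤ 1 := abs_prod_le_one fun i => (MTwo_abs_le hγ hγ1 (hle1 i)).1
  have hC : |1 - (2:ℝ) ^ k / 8| ≤ 1 + 2 ^ ⌊1 / etaP γ⌋₊ / 8 := by
    have : (2:ℝ) ^ k ≤ 2 ^ ⌊1 / etaP γ⌋₊ := pow_le_pow_right₀ (by norm_num) hkf
    have h0 : 0 ≤ (2:ℝ) ^ k := by positivity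
    rw [abs_le]; constructor <;> linarith
  calc |(∏ i, MOne γ (v i)) + (1 - (2:ℝ) ^ k / 8) * (∏ i, MTwo γ (v i)) / gZero γ|
      ≤ |∏ i, MOne γ (v i)| + |(1 - (2:ℝ) ^ k / 8) * (∏ i, MTwo γ (v i)) / gZero γ| := abs_add_le _ _
    _ = |∏ i, MOne γ (v i)| + |1 - (2:ℝ) ^ k / 8| * |∏ i, MTwo γ (v i)| / gZero γ := by
        rw [abs_div, abs_mul, abs_of_pos hg]
    _ ≤ 1 + (1 + 2 ^ ⌊1 / etaP γ⌋₊ / 8) * 1 / gZero γ := by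
        have hnum : |1 - (2:ℝ) ^ k / 8| * |∏ i, MTwo γ (v i)| ≤ (1 + 2 ^ ⌊1 / etaP γ⌋₊ / 8) * 1 :=
          mul_le_mul hC hB (abs_nonneg _) (by positivity)
        exact add_le_add hA (div_le_div_of_nonneg_right hnum hg.le)
    _ = 1 + (1 + 2 ^ ⌊1 / etaP γ⌋₊ / 8) / gZero γ := by ring

end Construction

/-! ### The values of `f`: `f(1) < −1` and `f ≥ −1` in dimension `≥ 2` -/

section Values

variable {γ : ℝ}

/-- **`f(1) < −1`** ("contribution to primes"). [cite: FordMaynard2024PrimeSieves, §9.2] -/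
theorem fmF_one_lt (hγ : 1 / 2 < γ) (hγ1 : γ < 1) : fmF γ 1 (fun _ => 1) < -1 := by
  unfold fmF
  simp only [Finset.univ_unique, Fin.default_eq_zero, Finset.sum_singleton, if_true,
    Finset.prod_singleton, pow_one]
  have hg := gZero_pos γ
  have h1 := (MOne_bounds hγ hγ1 (a := 1) (by linarith [etaP_le_one hγ hγ1]) le_rfl).2
  have h2 := (MTwo_bounds hγ hγ1 (a := 1) (by linarith [epsP_le_one hγ hγ1]) le_rfl).2
  -- `f(1) ≤ -1 + 1/(4g₀) + (3/4)(-3/4)/g₀ = -1 - (5/16)/g₀`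
  have : (1 - (2:ℝ) / 8) * MTwo γ 1 / gZero γ ≤ (3 / 4) * (-3 / 4) / gZero γ := by
    refine div_le_div_of_nonneg_right ?_ hg.le
    nlinarith
  have h3 : (3 / 4 : ℝ) * (-3 / 4) / gZero γ = -(9 / 16) / gZero γ := by ring
  have h4 : 1 / (4 * gZero γ) = (1 / 4) / gZero γ := by field_simp
  rw [h4] at h1
  rw [h3] at this
  have key : MOne γ 1 + (1 - (2:ℝ) / 8) * MTwo γ 1 / gZero γ ≤
      (-1 + (1 / 4) / gZero γ) + -(9 / 16) / gZero γ := add_le_add h1 this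
  have hneg : (1 / 4 : ℝ) / gZero γ + -(9 / 16) / gZero γ < 0 := by
    rw [← add_div]; exact div_neg_of_neg_of_pos (by norm_num) hg
  linarith

/-- Sign of a product of non-positive factors of modulus `≤ 1`: it is `≥ 0` if the number of
factors is even and `≥ −1`, `≤ 0` if it is odd. [folklore] -/
theorem prod_nonpos_factors {k : ℕ} {a : Fin k → ℝ} (h0 : ∀ i, a i ≤ 0) (h1 : ∀ i, |a i| ≤ 1) :
    (Even k → 0 ≤ ∏ i, a i) ∧ (Odd k → ∏ i, a i ≤ 0) ∧ -1 ≤ ∏ i, a i := by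
  have hprod : ∏ i, a i = (-1) ^ k * ∏ i, |a i| := by
    have h : ∏ i, a i = ∏ i : Fin k, ((-1 : ℝ) * |a i|) :=
      Finset.prod_congr rfl fun i _ => by rw [abs_of_nonpos (h0 i)]; ring
    rw [h, Finset.prod_mul_distrib, Finset.prod_const, Finset.card_univ, Fintype.card_fin]
  have hP0 : 0 ≤ ∏ i, |a i| := Finset.prod_nonneg fun i _ => abs_nonneg _
  have hP1 : ∏ i, |a i| ≤ 1 := Finset.prod_le_one (fun i _ => abs_nonneg _) fun i _ => h1 i
  refine ⟨fun he => ?_, fun ho => ?_, ?_⟩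
  · rw [hprod, he.neg_one_pow, one_mul]; exact hP0
  · rw [hprod, ho.neg_one_pow]; linarith
  · rw [hprod]
    rcases Nat.even_or_odd k with he | ho
    · rw [he.neg_one_pow]; linarith
    · rw [ho.neg_one_pow]; linarith

/-- **`f(β) ≥ −1` for all `β` of dimension `k ≥ 2`.** [cite: FordMaynard2024PrimeSieves, §9.2] -/
theorem fmF_ge_neg_one (hγ : 1 / 2 < γ) (hγ1 : γ < 1) {k : ℕ} (hk : 2 ≤ k) (β : Fin k → ℝ) :
    -1 ≤ fmF γ k β := by
  by_cases hz : fmF γ k β = 0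
  · rw [hz]; norm_num
  obtain ⟨hη, hsum⟩ := fmF_support hγ1 k β hz
  obtain ⟨hle1, hkη⟩ := le_one_of_support (etaP_pos hγ1) hη hsum
  have hg := gZero_pos γ
  have hg1 := one_le_gZero γ
  unfold fmF
  rw [if_pos hsum]
  have hA := prod_nonpos_factors (a := fun i => MOne γ (β i)) (fun i => (MOne_abs_le' hγ hγ1 (hle1 i)).2)
    (fun i => (MOne_abs_le' hγ hγ1 (hle1 i)).1)
  have hB := prod_nonpos_factors (a := fun i => MTwo γ (β i)) (fun i => (MTwo_abs_le hγ hγ1 (hle1 i)).2)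
    (fun i => (MTwo_abs_le hγ hγ1 (hle1 i)).1)
  -- the `g`-term: either some `β_i < ε` (then it vanishes) or `k ≤ 1/ε` (then `2^k ≤ g₀`)
  have hgterm : -1 ≤ (1 - (2:ℝ) ^ k / 8) * (∏ i, MTwo γ (β i)) / gZero γ ∧
      (Odd k → 0 ≤ (1 - (2:ℝ) ^ k / 8) * (∏ i, MTwo γ (β i)) / gZero γ) := by
    by_cases hε : ∀ i, epsP γ ≤ β i
    · obtain ⟨_, hkε⟩ := le_one_of_support (epsP_pos hγ1) hε hsum
      have hkf : k ≤ ⌈1 / epsP γ⌉₊ :=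
        (Nat.le_floor (by rw [le_div_iff₀ (epsP_pos hγ1)]; exact hkε)).trans (Nat.floor_le_ceil _)
      have h2k : (2:ℝ) ^ k ≤ gZero γ := by unfold gZero; exact pow_le_pow_right₀ (by norm_num) hkf
      have hP1 : |∏ i, MTwo γ (β i)| ≤ 1 := abs_prod_le_one fun i => (MTwo_abs_le hγ hγ1 (hle1 i)).1
      constructor
      · -- `|coefficient| ≤ 2^k ≤ g₀`
        have hc : |1 - (2:ℝ) ^ k / 8| ≤ (2:ℝ) ^ k := by
          have h4 : (4:ℝ) ≤ 2 ^ k := by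
            calc (4:ℝ) = 2 ^ 2 := by norm_num
              _ ≤ 2 ^ k := pow_le_pow_right₀ (by norm_num) hk
          rw [abs_le]; constructor <;> linarith
        have : |(1 - (2:ℝ) ^ k / 8) * (∏ i, MTwo γ (β i)) / gZero γ| ≤ 1 := by
          rw [abs_div, abs_mul, abs_of_pos hg, div_le_one hg]
          calc |1 - (2:ℝ) ^ k / 8| * |∏ i, MTwo γ (β i)| ≤ 2 ^ k * 1 :=
                mul_le_mul hc hP1 (abs_nonneg _) (by positivity)
            _ ≤ gZero γ := by linarith
        exact (abs_le.1 this).1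
      · intro ho
        have h8 : (8:ℝ) ≤ 2 ^ k := by
          have hk3 : 3 ≤ k := by obtain ⟨m, rfl⟩ := ho; omega
          calc (8:ℝ) = 2 ^ 3 := by norm_num
            _ ≤ 2 ^ k := pow_le_pow_right₀ (by norm_num) hk3
        have hcoef : 1 - (2:ℝ) ^ k / 8 ≤ 0 := by linarith
        exact div_nonneg (mul_nonneg_of_nonpos_of_nonpos hcoef (hB.2.1 ho)) hg.le
    · push Not at hε
      obtain ⟨i, hi⟩ := hε
      rw [Finset.prod_eq_zero (Finset.mem_univ i) (MTwo_of_lt hγ1 hi)]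
      simp
  rcases Nat.even_or_odd k with he | ho
  · linarith [hA.1 he, hgterm.1]
  · linarith [hA.2.2, hgterm.2 ho]

end Values

/-! ### The Type-I identity for `f` -/

section TypeI

variable {γ : ℝ}

/-- Products over `Fin (r + d)` of a function of `Fin.append ξ u` split. [folklore] -/
theorem prod_append {r d : ℕ} (φ : ℝ → ℝ) (ξ : Fin r → ℝ) (u : Fin d → ℝ) :
    ∏ i, φ (Fin.append ξ u i) = (∏ i, φ (ξ i)) * ∏ j, φ (u j) := by
  rw [Fin.prod_univ_add]
  simp [Fin.append_left, Fin.append_right]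

/-- Sums over `Fin (r + d)` of `Fin.append ξ u` split. [folklore] -/
theorem sum_append {r d : ℕ} (ξ : Fin r → ℝ) (u : Fin d → ℝ) :
    ∑ i, Fin.append ξ u i = (∑ i, ξ i) + ∑ j, u j := by
  rw [Fin.sum_univ_add]
  simp [Fin.append_left, Fin.append_right]

/-- `M₁(t)/t = ℓ₁(t)` and `M₂(t)/t = ℓ₂(t)` for `t ≠ 0`. [cite: FordMaynard2024PrimeSieves, §9.2] -/
theorem modLiouville_div {η c t : ℝ} (ht : t ≠ 0) :
    modLiouville η c t / t = ellFn (truncKernel η c) (dkOrder η) t := by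
  rw [modLiouville, mul_div_cancel_left₀ _ ht]

/-- If some fixed component is `< η`, all the Type-I terms of `f` vanish. [cite: FordMaynard2024PrimeSieves, §9.2] -/
theorem typeITerm_fmF_eq_zero_of_lt (hγ1 : γ < 1) {r : ℕ} {ξ : Fin r → ℝ} {i : Fin r}
    (hi : ξ i < etaP γ) (d : ℕ) : typeITerm (fmF γ) r ξ d = 0 := by
  unfold typeITerm
  have h0 : ∀ u : Fin d → ℝ, fmF γ (r + d) (Fin.append ξ u) = 0 := by
    intro u
    by_contra hne
    have := (fmF_support hγ1 _ _ hne).1 (Fin.castAdd d i)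
    rw [Fin.append_left] at this
    linarith
  rw [sliceIntegral_congr (G' := fun _ => 0) (fun u _ _ => by rw [h0 u, zero_div]), sliceIntegral_zero,
    mul_zero]

/-- **Evaluation of the Type-I terms of `f`** when all fixed components are `≥ η`:
`typeITerm f r ξ (d+1) = (1/(d+1)!) [A₁ ℓ₁^{⋆(d+1)}(w) + (A₂/g₀)(ℓ₂^{⋆(d+1)}(w) − (2^r/8) (2ℓ₂)^{⋆(d+1)}(w))]`,
`w = 1 − |ξ|`, `A_i = ∏ M_i(ξ_j)`. [cite: FordMaynard2024PrimeSieves, §9.2] -/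
theorem typeITerm_fmF_eq (hγ1 : γ < 1) {r : ℕ} {ξ : Fin r → ℝ} (hw : 0 < 1 - ∑ i, ξ i) (d : ℕ) :
    typeITerm (fmF γ) r ξ (d + 1) = (1 / ((d + 1).factorial : ℝ)) *
      ((∏ i, MOne γ (ξ i)) * cpow (ellFn (truncKernel (etaP γ) (cOne γ)) (dkOrder (etaP γ))) (d + 1) (1 - ∑ i, ξ i)
        + (∏ i, MTwo γ (ξ i)) / gZero γ *
          (cpow (ellFn (truncKernel (epsP γ) (cTwo γ)) (dkOrder (epsP γ))) (d + 1) (1 - ∑ i, ξ i)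
            - (2:ℝ) ^ r / 8 * cpow (fun t => 2 * ellFn (truncKernel (epsP γ) (cTwo γ)) (dkOrder (epsP γ)) t)
                (d + 1) (1 - ∑ i, ξ i))) := by
  set w := 1 - ∑ i, ξ i with hwdef
  set ℓ₁ := ellFn (truncKernel (etaP γ) (cOne γ)) (dkOrder (etaP γ)) with hℓ₁
  set ℓ₂ := ellFn (truncKernel (epsP γ) (cTwo γ)) (dkOrder (epsP γ)) with hℓ₂
  set A₁ := ∏ i, MOne γ (ξ i) with hA₁
  set A₂ := ∏ i, MTwo γ (ξ i) with hA₂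
  have hl₁ : LocBdd ℓ₁ := locBdd_ellFn (locBdd_truncKernel (etaP_pos hγ1) _) _
  have hl₂ : LocBdd ℓ₂ := locBdd_ellFn (locBdd_truncKernel (epsP_pos hγ1) _) _
  have hl₂' : LocBdd (fun t => 2 * ℓ₂ t) := hl₂.const_mul 2
  unfold typeITerm
  congr 1
  -- the integrand on the slice
  set B : ℝ := (1 - (2:ℝ) ^ (r + (d + 1)) / 8) * A₂ / gZero γ with hB
  have hint : ∀ u : Fin (d + 1) → ℝ, (∀ i, 0 < u i) → ∑ i, u i = w →
      fmF γ (r + (d + 1)) (Fin.append ξ u) / ∏ i, u i =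
        (A₁ * ∏ i, ℓ₁ (u i)) + (B * ∏ i, ℓ₂ (u i)) := by
    intro u hu hsum
    have hs : ∑ i, Fin.append ξ u i = 1 := by rw [sum_append, hsum, hwdef]; ring
    unfold fmF
    rw [if_pos hs, prod_append, prod_append, ← hA₁, ← hA₂, add_div]
    have hne : ∀ i, u i ≠ 0 := fun i => (hu i).ne'
    have hM₁ : (∏ j, MOne γ (u j)) / ∏ i, u i = ∏ j, ℓ₁ (u j) := by
      rw [← Finset.prod_div_distrib]
      exact Finset.prod_congr rfl fun j _ => modLiouville_div (hne j)
    have hM₂ : (∏ j, MTwo γ (u j)) / ∏ i, u i = ∏ j, ℓ₂ (u j) := by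
      rw [← Finset.prod_div_distrib]
      exact Finset.prod_congr rfl fun j _ => modLiouville_div (hne j)
    rw [mul_div_assoc, hM₁, hB]
    have : (1 - (2:ℝ) ^ (r + (d + 1)) / 8) * (A₂ * ∏ j, MTwo γ (u j)) / gZero γ / ∏ i, u i
        = (1 - (2:ℝ) ^ (r + (d + 1)) / 8) * A₂ / gZero γ * ((∏ j, MTwo γ (u j)) / ∏ i, u i) := by
      field_simp
    rw [this, hM₂]
  rw [sliceIntegral_congr hint]
  obtain ⟨C₁, hC₁0, hC₁⟩ := exists_bound_prod hl₁ A₁ d w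
  obtain ⟨C₂, hC₂0, hC₂⟩ := exists_bound_prod hl₂ B d w
  have hm₁ : Measurable fun u : Fin (d + 1) → ℝ => A₁ * ∏ i, ℓ₁ (u i) :=
    measurable_const.mul (Finset.measurable_prod _ fun i _ => hl₁.measurable.comp (measurable_pi_apply i))
  have hm₂ : Measurable fun u : Fin (d + 1) → ℝ => B * ∏ i, ℓ₂ (u i) :=
    measurable_const.mul (Finset.measurable_prod _ fun i _ => hl₂.measurable.comp (measurable_pi_apply i))
  rw [sliceIntegral_add d w hm₁ hm₂ (C := max C₁ C₂) (by positivity)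
      (fun v hv hs => (hC₁ v hv hs).trans (le_max_left _ _))
      (fun v hv hs => (hC₂ v hv hs).trans (le_max_right _ _)),
    sliceIntegral_const_mul_prod hl₁ A₁ d hw, sliceIntegral_const_mul_prod hl₂ B d hw, hB,
    cpow_const_mul 2 ℓ₂ (d + 1)]
  simp only []
  rw [pow_add]
  ring

/-- **`f` satisfies the Type-I identity (TypeI-f) with parameter `γ`.**
[cite: FordMaynard2024PrimeSieves, §9.2 and Lemma 9.5] -/
theorem fmF_typeI (hγ : 1 / 2 < γ) (hγ1 : γ < 1) : TypeIIdentity γ (fmF γ) := by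
  intro r ξ hξ
  refine ⟨max (dkOrder (etaP γ)) (dkOrder (epsP γ)), fun N hN => ?_⟩
  by_cases hlt : ∃ i, ξ i < etaP γ
  · obtain ⟨i, hi⟩ := hlt
    exact Finset.sum_eq_zero fun d _ => typeITerm_fmF_eq_zero_of_lt hγ1 hi d
  push Not at hlt
  have hsum0 : 0 ≤ ∑ i, ξ i := Finset.sum_nonneg fun i _ => (etaP_pos hγ1).le.trans (hlt i)
  have hwc : cOne γ ≤ 1 - ∑ i, ξ i := by unfold cOne; linarith
  have hw0 : 0 < 1 - ∑ i, ξ i := lt_of_lt_of_le (cOne_pos hγ1) hwc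
  have hN₁ : dkOrder (etaP γ) ≤ N := (le_max_left _ _).trans hN
  have hN₂ : dkOrder (epsP γ) ≤ N := (le_max_right _ _).trans hN
  -- shift the summation index `d = d' + 1`
  rw [show Finset.Icc 1 N = Finset.Ico 1 (N + 1) by rfl, Finset.sum_Ico_eq_sum_range, Nat.add_sub_cancel]
  simp_rw [show ∀ k, 1 + k = k + 1 from fun k => add_comm 1 k, typeITerm_fmF_eq hγ1 hw0]
  -- the three vanishing sums
  have hwin₁ : (3:ℝ) < (dkOrder (etaP γ) + 1) * etaP γ := by
    have := dkOrder_mul_gt (etaP_pos hγ1); nlinarith [etaP_pos hγ1]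
  have hwin₂ : (3:ℝ) < (dkOrder (epsP γ) + 1) * epsP γ := by
    have := dkOrder_mul_gt (epsP_pos hγ1); nlinarith [epsP_pos hγ1]
  have hwA : (1 - ∑ i, ξ i) ∈ Set.Icc (0:ℝ) 3 := ⟨hw0.le, by linarith⟩
  have S₁ := sum_cpow_ellFn_eq_zero (locBdd_truncKernel (etaP_pos hγ1) (cOne γ))
    (fun t ht => truncKernel_of_lt_eta (etaP_pos hγ1) ht) (cOne_pos hγ1).le
    (fun t ht => truncKernel_of_le ht) hN₁ hwin₁ 1 hwA (by simpa using hwc)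
  have S₂ := sum_cpow_ellFn_eq_zero (locBdd_truncKernel (epsP_pos hγ1) (cTwo γ))
    (fun t ht => truncKernel_of_lt_eta (epsP_pos hγ1) ht) (cTwo_pos hγ1).le
    (fun t ht => truncKernel_of_le ht) hN₂ hwin₂ 1 hwA
    (by have := cTwo_lt_cOne hγ1; simp; linarith)
  have S₃ := sum_cpow_ellFn_eq_zero (locBdd_truncKernel (epsP_pos hγ1) (cTwo γ))
    (fun t ht => truncKernel_of_lt_eta (epsP_pos hγ1) ht) (cTwo_pos hγ1).le
    (fun t ht => truncKernel_of_le ht) hN₂ hwin₂ 2 hwA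
    (by rw [Nat.cast_ofNat, two_mul_cTwo]; exact hwc)
  rw [show Finset.Icc 1 N = Finset.Ico 1 (N + 1) by rfl, Finset.sum_Ico_eq_sum_range,
    Nat.add_sub_cancel] at S₁ S₂ S₃
  simp_rw [show ∀ k, 1 + k = k + 1 from fun k => add_comm 1 k] at S₁ S₂ S₃
  simp only [Nat.cast_one, one_pow] at S₁ S₂
  -- `(2ℓ₂)^{⋆(d+1)} = 2^{d+1} ℓ₂^{⋆(d+1)}`
  have hS₃ : ∑ x ∈ Finset.range N, 1 / ((x + 1).factorial : ℝ) *
      cpow (fun t => 2 * ellFn (truncKernel (epsP γ) (cTwo γ)) (dkOrder (epsP γ)) t) (x + 1)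
        (1 - ∑ i, ξ i) = 0 := by
    rw [← S₃]
    refine Finset.sum_congr rfl fun x _ => ?_
    rw [cpow_const_mul]
    push_cast
    ring
  -- assemble
  have key : ∀ x ∈ Finset.range N, 1 / ((x + 1).factorial : ℝ) *
      ((∏ i, MOne γ (ξ i)) * cpow (ellFn (truncKernel (etaP γ) (cOne γ)) (dkOrder (etaP γ))) (x + 1) (1 - ∑ i, ξ i)
        + (∏ i, MTwo γ (ξ i)) / gZero γ *
          (cpow (ellFn (truncKernel (epsP γ) (cTwo γ)) (dkOrder (epsP γ))) (x + 1) (1 - ∑ i, ξ i)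
            - (2:ℝ) ^ r / 8 * cpow (fun t => 2 * ellFn (truncKernel (epsP γ) (cTwo γ)) (dkOrder (epsP γ)) t) (x + 1) (1 - ∑ i, ξ i)))
      = (∏ i, MOne γ (ξ i)) * (1 / ((x + 1).factorial : ℝ) *
          cpow (ellFn (truncKernel (etaP γ) (cOne γ)) (dkOrder (etaP γ))) (x + 1) (1 - ∑ i, ξ i))
        + (∏ i, MTwo γ (ξ i)) / gZero γ * (1 / ((x + 1).factorial : ℝ) *
          cpow (ellFn (truncKernel (epsP γ) (cTwo γ)) (dkOrder (epsP γ))) (x + 1) (1 - ∑ i, ξ i))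
        - (∏ i, MTwo γ (ξ i)) / gZero γ * ((2:ℝ) ^ r / 8) * (1 / ((x + 1).factorial : ℝ) *
            cpow (fun t => 2 * ellFn (truncKernel (epsP γ) (cTwo γ)) (dkOrder (epsP γ)) t) (x + 1)
              (1 - ∑ i, ξ i)) := by
    intro x _; ring
  rw [Finset.sum_congr rfl key, Finset.sum_sub_distrib, Finset.sum_add_distrib, ← Finset.mul_sum,
    ← Finset.mul_sum, ← Finset.mul_sum]
  rw [S₁, S₂, hS₃]
  ring

end TypeI


end Literature.NumberTheory.Sieve.FordMaynard
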